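import Literature.Topology.FourManifolds.HCobordismTransitivity
import Literature.Topology.FourManifolds.CobordismAttachmentHomology
import HarnessLib

/-!
# Composition of cobordisms, keeping the pieces: fundamental group and Mayer–Vietoris of a composite

Topic `Literature/Topology/FourManifolds` (fact seat of
`Literature.Topology.FourManifolds.isHCobordant_of_equivalent_intersectionForm`, Wall 1964 Thm. 2,
along R. Kirby's proof, *The topology of 4-manifolds*, LNM 1374 (1989), Ch. X, proof of Thm. 1,
pp. 55–56: the bordism between `M₀` and `M₁` is cut along its middle level into the two halves
`Mᵢ × I ∪ 2-handles` — composites of elementary cobordisms — which are then reglued by a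
diffeomorphism of the middle level; "everything is simply connected so it is an h-cobordism" and
"the 2- and 3-handles will cancel homologically" are the van Kampen and Mayer–Vietoris statements
for such composites proved here).

J. Milnor, *Lectures on the h-cobordism theorem* (1965), Thm. 1.4: the triads `(W₁; M, N)` and
`(W₂; N, P)` glue to a triad `(W₁ ∪_N W₂; M, P)`.  The tree proves this as `IsCobordant.trans_succ`
(`BordismFourTransitivity.lean`) on the witness `V = W₁ ∪_{∂W₁ = M ⊔ N} ((M × [0, 1]) ⊔ W₂)` of
its attachment theorem `exists_cobordismAttachment_holds`, and `IsHCobordant.trans_succ`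
(`HCobordismTransitivity.lean`) analyses the three closed pieces `W₁`, `M × [0, 1]`, `W₂` of `V`.
This file keeps the PIECES of that composite and proves what Kirby's regluing uses about them.
Everything is PROVED (theorems only); no definition and no named fact is introduced.

* `Cobordism.exists_composite` — **a composite of `c₁ : M ~ N` and `c₂ : N ~ P` with its pieces**
  (Milnor's Thm. 1.4 with the pieces kept): a cobordism `c` from `M` to `P` with continuous
  injective maps `e₁ : W₁ → W`, `e₂ : W₂ → W` such that `e₁ ∘ inr₁ = e₂ ∘ inl₂` on `N` (the seam),
  `c.inr = e₂ ∘ inr₂`, `c.inl ≃ e₁ ∘ inl₁` (homotopic: the incoming end of the witness is the far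
  end `M × {1}` of the collar cylinder), together with the two qualitative consequences
  - **van Kampen**: `W` is simply connected when `W₁`, `W₂` are and `N` is path connected;
  - **Mayer–Vietoris**: `Hⱼ₊₁(W₁) ⊕ Hⱼ₊₁(W₂) → Hⱼ₊₁(W)`, `(a, b) ↦ e₁_* a + e₂_* b`, is onto when
    `Hⱼ(N) = 0`.
  Proof: in
  `V = W₁ ∪ (M × [0, 1]) ∪ W₂` the cylinder strongly deformation retracts onto its bottom
  `M × {0} ⊆ W₁` (`Cobordism.isStrongDeformationRetractOf_range_inl` for the cylinder, pasted by
  `IsStrongDeformationRetractOf.union_of_inter_subset`), so `Z = W₁ ∪ W₂ ↪ V` is a homotopy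
  equivalence (`IsHomotopyEquiv.of_isStrongDeformationRetractOf_range`); and `Z` is a gluing of
  `W₁` and `W₂` along the bottom of a collar of the incoming end `N` of `W₂`
  (`Cobordism.exists_boundaryCollar_inl`, `BoundaryCollar.GluingData` with seam map `inr₁`), to
  which the tree's `GluingData.simplyConnectedSpace_of_simplyConnectedSpace` (Hatcher 2002,
  Lemma 1.15 with Prop. 3.42) and `GluingData.epi_biprodDesc_map` (Hatcher 2002, §2.2 p. 149)
  apply.
* `Cobordism.exists_add_eq_of_epi_biprodDesc` — every class of the target of an epimorphism
  `biprod.desc f g` is `f a + g b` (bookkeeping for the Mayer–Vietoris statement).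

## References

* J. Milnor, *Lectures on the h-cobordism theorem*, Princeton (1965), §1, Thm. 1.4. [MilnorHCobordism1965]
* A. Hatcher, *Algebraic Topology*, CUP (2002), Lemma 1.15, Prop. 3.42, §2.2 p. 149. [HatcherAT2002]
* R. C. Kirby, *The topology of 4-manifolds*, LNM 1374, Springer (1989), Ch. X, proof of Thm. 1,
  pp. 55–56. [Kirby1989]
-/

noncomputable section

open scoped Manifold ContDiff Topology unitInterval
open Set Function Topology CategoryTheory CategoryTheory.Limits
open Literature.AlgebraicTopology.Homotopy Literature.AlgebraicTopology.SingularHomology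

universe u

namespace Literature.Topology.FourManifolds

namespace Cobordism

variable {n : ℕ} {M N P : Type u}
  [TopologicalSpace M] [ChartedSpace (EuclideanSpace ℝ (Fin (n + 1))) M]
  [TopologicalSpace N] [ChartedSpace (EuclideanSpace ℝ (Fin (n + 1))) N]
  [TopologicalSpace P] [ChartedSpace (EuclideanSpace ℝ (Fin (n + 1))) P]

/-- **Every class of the target of an epimorphism `(f g) : A ⊞ B → C` is `f a + g b`**
(bookkeeping for Mayer–Vietoris surjectivity statements). [folklore] -/
theorem exists_add_eq_of_epi_biprodDesc {A B C : ModuleCat.{u} ℤ} (f : A ⟶ C) (g : B ⟶ C)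
    [Epi (biprod.desc f g)] (z : C) : ∃ (a : A) (b : B), f a + g b = z := by
  obtain ⟨w, hw⟩ := (ModuleCat.epi_iff_surjective _).1 (inferInstance : Epi (biprod.desc f g)) z
  refine ⟨(biprod.fst : A ⊞ B ⟶ A) w, (biprod.snd : A ⊞ B ⟶ B) w, ?_⟩
  rw [← hw, biprod.desc_eq]
  rfl

/-- **Existence of a composite with its pieces** (Milnor 1965, Thm. 1.4; fundamental group and
Mayer–Vietoris of the composite: Hatcher 2002, Lemma 1.15 / Prop. 3.42 and §2.2 p. 149), for
closed smooth manifolds of positive dimension `n + 1`.  The witness is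
`V = W₁ ∪_{M ⊔ N} ((M × [0, 1]) ⊔ W₂)` of `IsCobordant.trans_succ` read from `M × {1}` to `P`; the
cylinder strongly deformation retracts onto `M × {0} ⊆ W₁`, so `W₁ ∪ W₂ ↪ V` is a homotopy
equivalence, and `W₁ ∪ W₂` is a gluing along the bottom of a collar of `N` in `W₂`.
[cite: MilnorHCobordism1965, §1, Thm. 1.4] [cite: HatcherAT2002, Lemma 1.15, Prop. 3.42, §2.2 p. 149] -/
theorem exists_composite [T2Space M] [SecondCountableTopology M]
    [IsManifold (𝓡 (n + 1)) ∞ M] [CompactSpace M] [IsManifold (𝓡 (n + 1)) ∞ N] [CompactSpace N]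
    [IsManifold (𝓡 (n + 1)) ∞ P] [CompactSpace P]
    (c₁ : Cobordism (n + 1) M N) (c₂ : Cobordism (n + 1) N P) :
    ∃ (c : Cobordism (n + 1) M P) (e₁ : C(c₁.W, c.W)) (e₂ : C(c₂.W, c.W)),
      Injective e₁ ∧ Injective e₂ ∧
      (∀ y, e₁ (c₁.inr y) = e₂ (c₂.inl y)) ∧
      (∀ p, c.inr p = e₂ (c₂.inr p)) ∧
      (⟨c.inl, c.continuous_inl⟩ : C(M, c.W)).Homotopic (e₁.comp ⟨c₁.inl, c₁.continuous_inl⟩) ∧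
      (SimplyConnectedSpace c₁.W → SimplyConnectedSpace c₂.W → PathConnectedSpace N →
        SimplyConnectedSpace c.W) ∧
      (Nonempty N → ∀ j, IsZero (singularHomology ℤ ℤ N j) →
        Epi (biprod.desc (singularHomology.map ℤ ℤ e₁ (j + 1))
          (singularHomology.map ℤ ℤ e₂ (j + 1)))) := by
  -- `∂W₁ = M ⊔ N` as a boundary datum
  let b : BoundaryData (𝓡∂ (n + 2)) c₁.W (𝓡 (n + 1)) :=
    { carrier := M ⊕ N
      incl := Sum.elim c₁.inl c₁.inr
      isSmoothEmbedding := c₁.isSmoothEmbedding_inl.sumElim c₁.isSmoothEmbedding_inr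
        c₁.disjoint_range
      range_incl := by rw [Set.Sum.elim_range, c₁.range_inl_union_range_inr] }
  -- the cylinder on `M`, an h-cobordism
  let C : Cobordism (n + 1) M M := cylinderCobordism (n + 1) M
  have hC : C.IsHCobordism := cylinderCobordism_isHCobordism (n + 1) M
  -- the cobordism `(M × [0, 1]) ⊔ W₂` from `M ⊔ N` to `M ⊔ P`
  let X : Cobordism (n + 1) (M ⊕ N) (M ⊕ P) :=
    { W := C.W ⊕ c₂.W
      inl := Sum.map C.inl c₂.inl
      inr := Sum.map C.inr c₂.inr
      isSmoothEmbedding_inl := C.isSmoothEmbedding_inl.sumMap c₂.isSmoothEmbedding_inl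
      isSmoothEmbedding_inr := C.isSmoothEmbedding_inr.sumMap c₂.isSmoothEmbedding_inr
      disjoint_range := C.disjoint_range_sumMap c₂
      range_inl_union_range_inr := C.range_sumMap_union_range_sumMap c₂ }
  -- attach it to `W₁` along the identity of `M ⊔ N`
  obtain ⟨V, _, _, _, _, _, ⟨A⟩⟩ := exists_cobordismAttachment_holds n c₁.W b (M ⊕ N) (M ⊕ P) X
    (Diffeomorph.refl (𝓡 (n + 1)) (M ⊕ N) ∞)
  haveI : CompactSpace V := A.compactSpace
  -- `∂V = M ⊔ P`: a cobordism from `M` to `P`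
  let Y : Cobordism (n + 1) M P :=
    { W := V
      inl := (A.jX ∘ X.inr) ∘ Sum.inl
      inr := (A.jX ∘ X.inr) ∘ Sum.inr
      isSmoothEmbedding_inl := isSmoothEmbedding_comp_inl A.isSmoothEmbedding_jX_comp_inr
      isSmoothEmbedding_inr := isSmoothEmbedding_comp_inr A.isSmoothEmbedding_jX_comp_inr
      disjoint_range := Set.disjoint_left.2 (by
        rintro _ ⟨x, rfl⟩ ⟨y, hy⟩
        exact Sum.inr_ne_inl (A.isSmoothEmbedding_jX_comp_inr.isEmbedding.injective hy))
      range_inl_union_range_inr := by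
        rw [← A.range_jX_comp_inr]
        ext v
        constructor
        · rintro (⟨x, rfl⟩ | ⟨y, rfl⟩)
          · exact ⟨Sum.inl x, rfl⟩
          · exact ⟨Sum.inr y, rfl⟩
        · rintro ⟨x | y, rfl⟩
          · exact Or.inl ⟨x, rfl⟩
          · exact Or.inr ⟨y, rfl⟩ }
  -- the embeddings of the three pieces `W₁`, `M × [0, 1]`, `W₂`
  let eC : C.W → V := A.jX ∘ Sum.inl
  let e₂ : c₂.W → V := A.jX ∘ Sum.inr
  have hjX : IsEmbedding A.jX := A.isSmoothEmbedding_jX.isEmbedding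
  have heC : IsEmbedding eC := hjX.comp IsEmbedding.inl
  have he₂ : IsEmbedding e₂ := hjX.comp IsEmbedding.inr
  -- the seams
  have hseam : ∀ w x, A.jW w = A.jX x ↔ ∃ z, w = b.incl z ∧ x = X.inl z := fun w x =>
    A.jW_eq_jX_iff w x
  have hseam_l : ∀ m, A.jW (c₁.inl m) = eC (C.inl m) := fun m =>
    (hseam (c₁.inl m) (Sum.inl (C.inl m))).2 ⟨Sum.inl m, rfl, rfl⟩
  have hseam_r : ∀ y, A.jW (c₁.inr y) = e₂ (c₂.inl y) := fun y =>
    (hseam (c₁.inr y) (Sum.inr (c₂.inl y))).2 ⟨Sum.inr y, rfl, rfl⟩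
  -- the pieces and their intersections, as subsets of `V`
  have hcover : range A.jW ∪ range eC ∪ range e₂ = univ := by
    rw [union_assoc, ← A.range_union]
    congr 1
    ext v
    constructor
    · rintro (⟨x, rfl⟩ | ⟨y, rfl⟩)
      · exact ⟨Sum.inl x, rfl⟩
      · exact ⟨Sum.inr y, rfl⟩
    · rintro ⟨x | y, rfl⟩
      · exact Or.inl ⟨x, rfl⟩
      · exact Or.inr ⟨y, rfl⟩
  have hWC : range A.jW ∩ range eC ⊆ A.jW '' range c₁.inl := by
    rintro _ ⟨⟨w, rfl⟩, ⟨x, hx⟩⟩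
    obtain ⟨z, rfl, hz⟩ := (hseam w (Sum.inl x)).1 hx.symm
    rcases z with m | y
    · exact ⟨c₁.inl m, ⟨m, rfl⟩, rfl⟩
    · exact absurd hz Sum.inl_ne_inr
  have hC2 : range eC ∩ range e₂ = ∅ := by
    rw [eq_empty_iff_forall_notMem]
    rintro _ ⟨⟨x, rfl⟩, ⟨y, hy⟩⟩
    exact Sum.inr_ne_inl (hjX.injective hy)
  have hM0 : A.jW '' range c₁.inl = eC '' range C.inl := by
    ext v
    constructor
    · rintro ⟨_, ⟨m, rfl⟩, rfl⟩
      exact ⟨C.inl m, ⟨m, rfl⟩, (hseam_l m).symm⟩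
    · rintro ⟨_, ⟨m, rfl⟩, rfl⟩
      exact ⟨c₁.inl m, ⟨m, rfl⟩, hseam_l m⟩
  -- closedness of the pieces
  have hWcl : IsClosed (range A.jW) := (isCompact_range A.continuous_jW).isClosed
  have hCcl : IsClosed (range eC) := (isCompact_range heC.continuous).isClosed
  have h2cl : IsClosed (range e₂) := (isCompact_range he₂.continuous).isClosed
  -- the cylinder strongly deformation retracts onto its bottom `M × {0} = W₁ ∩ (M × [0, 1])`
  have hM0C : IsStrongDeformationRetractOf (A.jW '' range c₁.inl) (range eC) := by
    have := (C.isStrongDeformationRetractOf_range_inl hC.1).image_of_isEmbedding heC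
    rwa [image_univ, ← hM0] at this
  -- hence `V` strongly deformation retracts onto `Z = W₁ ∪ W₂`
  have hZcl : IsClosed (range A.jW ∪ range e₂) := hWcl.union h2cl
  have hZC : range A.jW ∪ range e₂ ∪ range eC = univ := by
    rw [union_right_comm]
    exact hcover
  have hZ : IsStrongDeformationRetractOf (range A.jW ∪ range e₂) univ := by
    have := hM0C.union_of_inter_subset (P := range A.jW ∪ range e₂)
      (fun v hv => by
        rcases hv.1 with hvW | hv2
        · exact hWC ⟨hvW, hv.2⟩
        · exact absurd (show v ∈ range eC ∩ range e₂ from ⟨hv.2, hv2⟩) (hC2 ▸ notMem_empty v))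
      (fun v hv => Or.inl (image_subset_range _ _ hv.1))
      (fun v hv => by rw [hZcl.closure_eq] at hv; exact hv.1)
      (fun v hv => by rw [hCcl.closure_eq] at hv; exact hv.1)
    rwa [hZC] at this
  -- `Z ↪ V` is a homotopy equivalence
  have hval : IsHomotopyEquiv (Subtype.val : ↥(range A.jW ∪ range e₂) → V) :=
    IsHomotopyEquiv.of_isStrongDeformationRetractOf_range IsEmbedding.subtypeVal
      (by rw [Subtype.range_coe]; exact hZ)
  -- `Z` is a gluing of `W₁` and `W₂` along the bottom of a collar of `N` in `W₂`
  obtain ⟨κ₂, hκ₂⟩ := c₂.exists_boundaryCollar_inl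
  haveI : CompactSpace ↥(range A.jW ∪ range e₂) := isCompact_iff_compactSpace.mp hZcl.isCompact
  let j₁ : c₁.W → ↥(range A.jW ∪ range e₂) := fun w => ⟨A.jW w, Or.inl ⟨w, rfl⟩⟩
  let j₂ : c₂.W → ↥(range A.jW ∪ range e₂) := fun x => ⟨e₂ x, Or.inr ⟨x, rfl⟩⟩
  have hj₁c : Continuous j₁ := A.continuous_jW.subtype_mk _
  have hj₂c : Continuous j₂ := he₂.continuous.subtype_mk _
  have hj₁i : Injective j₁ := fun a a' h => A.injective_jW (congrArg Subtype.val h)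
  have hj₂i : Injective j₂ := fun a a' h => he₂.injective (congrArg Subtype.val h)
  let d : κ₂.GluingData c₁.inr ↥(range A.jW ∪ range e₂) :=
    { j₁ := j₁
      j₂ := j₂
      isClosedEmbedding_j₁ := hj₁c.isClosedEmbedding hj₁i
      isClosedEmbedding_j₂ := hj₂c.isClosedEmbedding hj₂i
      range_union_range := by
        refine eq_univ_of_forall fun z => ?_
        rcases z.2 with ⟨w, hw⟩ | ⟨x, hx⟩
        · exact Or.inl ⟨w, Subtype.ext hw⟩
        · exact Or.inr ⟨x, Subtype.ext hx⟩
      j₁_eq_j₂_iff := fun a x => by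
        rw [Subtype.ext_iff]
        show A.jW a = A.jX (Sum.inr x) ↔ _
        rw [hseam]
        constructor
        · rintro ⟨z, rfl, hz⟩
          rcases z with m | y
          · exact absurd hz Sum.inr_ne_inl
          · refine ⟨y, rfl, ?_⟩
            rw [hκ₂]
            exact Sum.inr_injective hz
        · rintro ⟨y, rfl, rfl⟩
          exact ⟨Sum.inr y, rfl, by rw [hκ₂]; rfl⟩ }
  -- the continuous maps
  let e₁C : C(c₁.W, V) := ⟨A.jW, A.continuous_jW⟩
  let e₂C : C(c₂.W, V) := ⟨e₂, he₂.continuous⟩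
  let valC : C(↥(range A.jW ∪ range e₂), V) := ⟨Subtype.val, continuous_subtype_val⟩
  have hval1 : valC.comp d.j₁C = e₁C := by ext w; rfl
  have hval2 : valC.comp d.j₂C = e₂C := by ext x; rfl
  -- the homotopy `inl ≃ e₁ ∘ inl₁` through the slices of the cylinder
  let G : I × M → V := fun q =>
    eC ⟨(q.2, ((σ q.1 : I) : ℝ)), Cylinder.mem_carrier_iff.2 (σ q.1).2⟩
  have hG : Continuous G :=
    heC.continuous.comp ((continuous_snd.prodMk (continuous_subtype_val.comp
      (unitInterval.continuous_symm.comp continuous_fst))).subtype_mk _)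
  have hHom : (⟨Y.inl, Y.continuous_inl⟩ : C(M, V)).Homotopic (e₁C.comp ⟨c₁.inl, c₁.continuous_inl⟩) := by
    refine ⟨{ toFun := G
              continuous_toFun := hG
              map_zero_left := fun m => ?_
              map_one_left := fun m => ?_ }⟩
    · show eC _ = eC (C.inr m)
      congr 1
      refine Subtype.ext (Prod.ext rfl ?_)
      show ((σ 0 : I) : ℝ) = 1
      rw [unitInterval.symm_zero]
      rfl
    · show eC _ = A.jW (c₁.inl m)
      rw [hseam_l]
      congr 1
      refine Subtype.ext (Prod.ext rfl ?_)
      show ((σ 1 : I) : ℝ) = 0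
      rw [unitInterval.symm_one]
      rfl
  refine ⟨Y, e₁C, e₂C, A.injective_jW, he₂.injective, hseam_r, fun p => rfl, hHom,
    fun h₁ h₂ h₃ => ?_, fun hN j hj => ?_⟩
  · -- van Kampen on `Z`, transported along `Z ≃ V`
    haveI := h₁
    haveI := h₂
    haveI := h₃
    haveI : SimplyConnectedSpace ↥(range A.jW ∪ range e₂) :=
      d.simplyConnectedSpace_of_simplyConnectedSpace
    obtain ⟨e, -⟩ := hval
    exact e.symm.simplyConnectedSpace
  · -- Mayer–Vietoris on `Z`, transported along `Z ≃ V`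
    haveI := hN
    haveI := d.epi_biprodDesc_map ℤ ℤ hj
    obtain ⟨e, he⟩ := hval
    have hve : valC = e.toFun := by
      ext z
      exact (congrFun he z).symm
    haveI : IsIso (singularHomology.map ℤ ℤ valC (j + 1)) := by
      rw [hve]
      exact (singularHomology.isoOfHomotopyEquiv ℤ ℤ e (j + 1)).isIso_hom
    have hfac : biprod.desc (singularHomology.map ℤ ℤ e₁C (j + 1))
        (singularHomology.map ℤ ℤ e₂C (j + 1)) =
        biprod.desc (singularHomology.map ℤ ℤ d.j₁C (j + 1))
          (singularHomology.map ℤ ℤ d.j₂C (j + 1)) ≫ singularHomology.map ℤ ℤ valC (j + 1) := by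
      refine biprod.hom_ext' _ _ ?_ ?_
      · rw [biprod.inl_desc, biprod.inl_desc_assoc, ← singularHomology.map_comp, hval1]
      · rw [biprod.inr_desc, biprod.inr_desc_assoc, ← singularHomology.map_comp, hval2]
    rw [hfac]
    exact epi_comp _ _

end Cobordism

end Literature.Topology.FourManifolds

end
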